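import Summits.ValiantsHypothesis.ValiantsHypothesis.Theorems.LacunarySymmetroidMatrixDescartesDoorA26WallBubblingLocalOpening
import Summits.ValiantsHypothesis.ValiantsHypothesis.Theorems.LacunarySymmetroidMatrixDescartesDoorA26WallBubblingQuadZeroLift

/-!
# `DoorA26` / line `wall_bubbling` — THE NEWTON-POLYGON LIFT: every zero opened at its own scale, all multiplicity patterns at once

HONEST FRAMING.  Object-search cell `pub-symmetroid`, crux `Theses.LacunarySymmetroid.DoorA26` (stmt-ValiantsHypothesis-19979; OPEN, typed,
never asserted).  W2 seat val-sym-door-p1 g20, file #79; def-free helper for obligation (R) of `Cruxes/DoorA26/Lines/wall_bubbling.lean`.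
Imports #78 `…LocalOpening` (interval-by-interval counting) and #72 `…QuadZeroLift` (determinant expansions of polynomial families; brings #70
`…ScalingLimit` and #50's exponential-sum calculus).

THE THEOREM (`mem_twentyLocus_of_newton_openings`).  A family of symmetric letters `Sη η` whose determinant is a polynomial in `η` with
exponential-sum coefficients, `det Σ_l e^{δ_l t} Sη η l = Σ_{n ≤ N} ηⁿ c_n(t)`, `c_n = expSum (c n) x`.  Points `z_1 < ⋯ < z_r` at mutual distance
`≥ 2ρ` and, at each `z_j`, NEWTON DATA: a scale `α_j > 0`, a weight `β_j`, orders `k_{j,n}` with `c_n^{(i)}(z_j) = 0` for `i < k_{j,n}` and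
`β_j ≤ n + α_j k_{j,n}` for every `n`; the SCALING POLYNOMIAL `M_j(σ) = Σ_{n + α_j k_{j,n} = β_j} (c_n^{(k_{j,n})}(z_j)/k_{j,n}!) σ^{k_{j,n}}`; and
`m_j + 1` non-zero abscissae `σ_{j,0} < ⋯ < σ_{j,m_j}` at which `M_j` takes alternating signs `ε_{j,i}`.  If `Σ_j m_j ≥ 20` then
`δ ∈ TwentyLocus`: for small `η > 0` the determinant has the sign `ε_{j,i}` at `z_j + η^{α_j} σ_{j,i}` (#70), hence `m_j` zeros in
`(z_j − ρ, z_j + ρ)`, hence `≥ 20` zeros (#78).  SIMPLE zeros are the case `m_j = 1` (`α = 1`, `k_{j,0} = 1`, `M = c₀′(z_j)σ`), first-order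
TOUCHES the case `m_j = 2` (`α = 1/2`, `M = aσ² + c₁(z_j)`), NODES `α = 1` (`M = aσ² + c₁′σ + c₂`), the TRIPLE zero of #50 `α = 1/2`
(`M = aσ³ + c₁′σ`), the QUADRUPLE zero of #72 `α = 1/2` (`M = aσ⁴ + (c₁″/2)σ² + c₂`), the second-order cubic of #74 `α = 1`, and a rank-one
zero of ANY order `m` opened along the edge of slope `−2` (`α = 1/2`, even-step polynomial `Σ_{i ≤ m/2} b_{m−2i} σ^{m−2i}`) — all instances, in
any combination, with no frame to build.

ALSO HERE.  The two standard coefficient representations, so that users only supply letters: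
★ `mem_twentyLocus_of_newton_openings_linear` (family `S + ηT`: `c₀ = det P`, `c₁ = pol(P,Q)`, `c₂ = det Q`), ★ `mem_twentyLocus_of_newton_openings_quadratic`
(family `S + ηT₁ + η²T₂`: the five coefficients of #72).  Nothing here bears on `DoorA26`, `DoorA34`, (W)/(M)/(R), `MatrixDescartes` (18050) or
`VP ≠ VNP`; registers unchanged.

[folklore] Newton polygon; Taylor quotients.  [this work] the theorem and its packaging.
-/

set_option linter.dupNamespace false

namespace Summit.ValiantsHypothesis.ValiantsHypothesis.Theorems.LacunarySymmetroidMatrixDescartes.WallBubbling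

open Finset Filter Topology
open Bubbling (TwentyLocus expSum)

/-! ## §1 The abstract theorem -/

/-- ★★★ **THE NEWTON-POLYGON LIFT** (see the module docstring for the reading).  Family with polynomial-in-`η` determinant and exponential-sum
coefficients; separated points `z_j` with Newton data `(α_j, β_j, k_{j,·})`, scaling polynomials with `m_j + 1` alternation witnesses; `Σ m_j ≥ 20`
⇒ `δ ∈ TwentyLocus`. [this work] -/
theorem mem_twentyLocus_of_newton_openings (δ : Fin 6 → ℝ) (Sη : ℝ → Fin 6 → Matrix (Fin 2) (Fin 2) ℝ)
    (hS : ∀ η l, (Sη η l).IsSymm) {ι : Type*} [Fintype ι] {N : ℕ} (c : Fin (N + 1) → ι → ℝ) (x : ι → ℝ)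
    (hF : ∀ η t, (∑ l, Real.exp (δ l * t) • Sη η l).det = ∑ n : Fin (N + 1), η ^ (n : ℕ) * expSum (c n) x t)
    {r : ℕ} (z : Fin r → ℝ) {ρ : ℝ} (hρ : 0 < ρ) (hsep : ∀ i j : Fin r, i < j → z i + ρ ≤ z j - ρ)
    (m : Fin r → ℕ) (hm : 20 ≤ ∑ j, m j)
    (α : Fin r → ℝ) (hα : ∀ j, 0 < α j) (β : Fin r → ℝ) (k : Fin r → Fin (N + 1) → ℕ)
    (hvan : ∀ j (n : Fin (N + 1)), ∀ i < k j n, iteratedDeriv i (expSum (c n) x) (z j) = 0)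
    (hβ : ∀ j (n : Fin (N + 1)), β j ≤ ((n : ℕ) : ℝ) + α j * k j n)
    (σ : (j : Fin r) → Fin (m j + 1) → ℝ) (hσ : ∀ j, StrictMono (σ j)) (hσ0 : ∀ j i, σ j i ≠ 0)
    (ε : (j : Fin r) → Fin (m j + 1) → ℝ) (hεalt : ∀ j (i : Fin (m j)), ε j i.castSucc * ε j i.succ < 0)
    (hM : ∀ j i, 0 < ε j i * ∑ n : Fin (N + 1), if ((n : ℕ) : ℝ) + α j * k j n = β j then
        iteratedDeriv (k j n) (expSum (c n) x) (z j) / (k j n).factorial * σ j i ^ (k j n) else 0) :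
    δ ∈ TwentyLocus := by
  refine mem_twentyLocus_of_local_openings δ Sη hS (fun j => z j - ρ) (fun j => z j + ρ) hsep m hm
    (fun j η i => z j + η ^ (α j) * σ j i) ?_ ?_ ε hεalt ?_
  · -- each group is increasing for `η > 0`
    intro j
    filter_upwards [self_mem_nhdsWithin] with η hη
    intro i i' hii'
    have hpos : 0 < η ^ (α j) := Real.rpow_pos_of_pos hη _
    have := mul_lt_mul_of_pos_left (hσ j hii') hpos
    show z j + η ^ α j * σ j i < z j + η ^ α j * σ j i'
    linarith
  · -- each group is eventually inside `[z_j − ρ, z_j + ρ]`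
    intro j
    have h0 : Tendsto (fun η : ℝ => η ^ (α j) * σ j 0) (𝓝[>] 0) (𝓝 0) := by
      simpa using (tendsto_rpow_nhdsGT_zero (hα j)).mul_const (σ j 0)
    have h1 : Tendsto (fun η : ℝ => η ^ (α j) * σ j (Fin.last (m j))) (𝓝[>] 0) (𝓝 0) := by
      simpa using (tendsto_rpow_nhdsGT_zero (hα j)).mul_const (σ j (Fin.last (m j)))
    have e0 : ∀ᶠ η in 𝓝[>] (0 : ℝ), -ρ < η ^ (α j) * σ j 0 := h0.eventually (eventually_gt_nhds (by linarith))
    have e1 : ∀ᶠ η in 𝓝[>] (0 : ℝ), η ^ (α j) * σ j (Fin.last (m j)) < ρ := h1.eventually (eventually_lt_nhds hρ)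
    filter_upwards [e0, e1] with η hη0 hη1
    exact ⟨by linarith, by linarith⟩
  · -- eventual sign at `z_j + η^{α_j} σ_{j,i}`: the scaling limit #70
    intro j i
    have hc : ∀ n : Fin (N + 1), Tendsto (fun h => expSum (c n) x (z j + h) / h ^ (k j n)) (𝓝[≠] 0)
        (𝓝 (iteratedDeriv (k j n) (expSum (c n) x) (z j) / (k j n).factorial)) := by
      intro n
      have hv : ∀ i' < k j n, expSum (fun p => c n p * x p ^ i') x (z j) = 0 := fun i' hi' => by
        rw [← congrFun (iteratedDeriv_expSum (c n) x i') (z j)]; exact hvan j n i' hi'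
      have h := tendsto_expSum_div_pow x (z j) (k j n) (c n) hv
      rwa [← congrFun (iteratedDeriv_expSum (c n) x (k j n)) (z j)] at h
    have h := eventually_kappa_pos_scaling (fun n h => expSum (c n) x (z j + h)) (fun n : Fin (N + 1) => ((n : ℕ) : ℝ)) (k j)
      (fun n => iteratedDeriv (k j n) (expSum (c n) x) (z j) / (k j n).factorial) (hα j) (hσ0 j i) hc (β j) (hβ j)
      (ε j i) (hM j i)
    filter_upwards [h] with η hη
    rw [hF]
    simpa only [Real.rpow_natCast] using hη

/-! ## §2 Coefficient representations for linear and quadratic families of letters -/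

/-- ★ **NEWTON-POLYGON LIFT, linear family `S + ηT`.**  The three coefficients are `c₀ = det P`, `c₁ = det(P+Q) − det P − det Q`, `c₂ = det Q`
as functions of `t` (`P, Q` the pencils of `S, T`); Newton data and alternation witnesses per zero as in `mem_twentyLocus_of_newton_openings`,
phrased with `iteratedDeriv` of these three functions. [this work] -/
theorem mem_twentyLocus_of_newton_openings_linear (δ : Fin 6 → ℝ) (S T : Fin 6 → Matrix (Fin 2) (Fin 2) ℝ)
    (hS : ∀ l, (S l).IsSymm) (hT : ∀ l, (T l).IsSymm)
    {r : ℕ} (z : Fin r → ℝ) {ρ : ℝ} (hρ : 0 < ρ) (hsep : ∀ i j : Fin r, i < j → z i + ρ ≤ z j - ρ)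
    (m : Fin r → ℕ) (hm : 20 ≤ ∑ j, m j)
    (α : Fin r → ℝ) (hα : ∀ j, 0 < α j) (β : Fin r → ℝ) (k : Fin r → Fin 3 → ℕ)
    (hvan : ∀ j, ∀ n : Fin 3, ∀ i < k j n, iteratedDeriv i
      (![fun t => (∑ l, Real.exp (δ l * t) • S l).det,
         fun t => ((∑ l, Real.exp (δ l * t) • S l) + (∑ l, Real.exp (δ l * t) • T l)).det
            - (∑ l, Real.exp (δ l * t) • S l).det - (∑ l, Real.exp (δ l * t) • T l).det,
         fun t => (∑ l, Real.exp (δ l * t) • T l).det] n) (z j) = 0)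
    (hβ : ∀ j (n : Fin 3), β j ≤ ((n : ℕ) : ℝ) + α j * k j n)
    (σ : (j : Fin r) → Fin (m j + 1) → ℝ) (hσ : ∀ j, StrictMono (σ j)) (hσ0 : ∀ j i, σ j i ≠ 0)
    (ε : (j : Fin r) → Fin (m j + 1) → ℝ) (hεalt : ∀ j (i : Fin (m j)), ε j i.castSucc * ε j i.succ < 0)
    (hM : ∀ j i, 0 < ε j i * ∑ n : Fin 3, if ((n : ℕ) : ℝ) + α j * k j n = β j then
        iteratedDeriv (k j n)
          (![fun t => (∑ l, Real.exp (δ l * t) • S l).det,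
             fun t => ((∑ l, Real.exp (δ l * t) • S l) + (∑ l, Real.exp (δ l * t) • T l)).det
                - (∑ l, Real.exp (δ l * t) • S l).det - (∑ l, Real.exp (δ l * t) • T l).det,
             fun t => (∑ l, Real.exp (δ l * t) • T l).det] n) (z j) / (k j n).factorial * σ j i ^ (k j n) else 0) :
    δ ∈ TwentyLocus := by
  classical
  -- exponential-sum representations (Leibniz index)
  let ι := Equiv.Perm (Fin 2) × (Fin 2 → Fin 6)
  let x : ι → ℝ := fun p => ∑ i, δ (p.2 i)
  let lb : (Fin 6 → Matrix (Fin 2) (Fin 2) ℝ) → ι → ℝ := fun U p => ((Equiv.Perm.sign p.1 : ℤ) : ℝ) * ∏ i, U (p.2 i) (p.1 i) i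
  have ev : ∀ (U : Fin 6 → Matrix (Fin 2) (Fin 2) ℝ) (t : ℝ), (∑ l, Real.exp (δ l * t) • U l).det = expSum (lb U) x t :=
    fun U t => congrFun (det_expPencil_eq_expSum_fun δ U) t
  let c : Fin 3 → ι → ℝ := ![lb S, fun p => lb (fun l => S l + T l) p - lb S p - lb T p, lb T]
  -- the three coefficient functions are these exponential sums
  have hc : (![fun t => (∑ l, Real.exp (δ l * t) • S l).det,
         fun t => ((∑ l, Real.exp (δ l * t) • S l) + (∑ l, Real.exp (δ l * t) • T l)).det
            - (∑ l, Real.exp (δ l * t) • S l).det - (∑ l, Real.exp (δ l * t) • T l).det,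
         fun t => (∑ l, Real.exp (δ l * t) • T l).det] : Fin 3 → ℝ → ℝ) = fun n => expSum (c n) x := by
    funext n
    fin_cases n
    · funext t; exact ev S t
    · funext t
      show ((∑ l, Real.exp (δ l * t) • S l) + (∑ l, Real.exp (δ l * t) • T l)).det
            - (∑ l, Real.exp (δ l * t) • S l).det - (∑ l, Real.exp (δ l * t) • T l).det = expSum (c 1) x t
      rw [expPencil_add, ev, ev, ev, expSum_sub_sub]
      rfl
    · funext t; exact ev T t
  rw [hc] at hvan hM
  -- the family and its determinant
  let Sη : ℝ → Fin 6 → Matrix (Fin 2) (Fin 2) ℝ := fun η l => S l + η • T l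
  have hSη : ∀ η l, (Sη η l).IsSymm := fun η l => (hS l).add ((hT l).smul η)
  have hF : ∀ η t, (∑ l, Real.exp (δ l * t) • Sη η l).det = ∑ n : Fin 3, η ^ (n : ℕ) * expSum (c n) x t := by
    intro η t
    show (∑ l, Real.exp (δ l * t) • (S l + η • T l)).det = _
    rw [expPencil_pencilShift, det_add_smul_fin_two, Fin.sum_univ_three]
    have h0 := congrFun (congrFun hc 0) t
    have h1 := congrFun (congrFun hc 1) t
    have h2 := congrFun (congrFun hc 2) t
    simp only [Matrix.cons_val_zero, Matrix.cons_val_one, Matrix.head_cons, Matrix.cons_val_two, Matrix.tail_cons] at h0 h1 h2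
    rw [← h0, ← h1, ← h2, expPencil_add]
    simp only [Fin.val_zero, Fin.val_one, Fin.val_two, pow_zero, one_mul, pow_one]
  exact mem_twentyLocus_of_newton_openings δ Sη hSη c x hF z hρ hsep m hm α hα β k hvan hβ σ hσ hσ0 ε hεalt hM

/-- ★ **NEWTON-POLYGON LIFT, quadratic family `S + ηT₁ + η²T₂`.**  The five coefficients are those of #72:
`c₀ = det P`, `c₁ = pol(P,Q₁)`, `c₂ = pol(P,Q₂) + det Q₁`, `c₃ = pol(Q₁,Q₂)`, `c₄ = det Q₂` with `pol(X,Y) = det(X+Y) − det X − det Y`. [this work] -/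
theorem mem_twentyLocus_of_newton_openings_quadratic (δ : Fin 6 → ℝ) (S T₁ T₂ : Fin 6 → Matrix (Fin 2) (Fin 2) ℝ)
    (hS : ∀ l, (S l).IsSymm) (hT₁ : ∀ l, (T₁ l).IsSymm) (hT₂ : ∀ l, (T₂ l).IsSymm)
    {r : ℕ} (z : Fin r → ℝ) {ρ : ℝ} (hρ : 0 < ρ) (hsep : ∀ i j : Fin r, i < j → z i + ρ ≤ z j - ρ)
    (m : Fin r → ℕ) (hm : 20 ≤ ∑ j, m j)
    (α : Fin r → ℝ) (hα : ∀ j, 0 < α j) (β : Fin r → ℝ) (k : Fin r → Fin 5 → ℕ)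
    (hvan : ∀ j, ∀ n : Fin 5, ∀ i < k j n, iteratedDeriv i
      (![fun t => (∑ l, Real.exp (δ l * t) • S l).det,
         fun t => ((∑ l, Real.exp (δ l * t) • S l) + (∑ l, Real.exp (δ l * t) • T₁ l)).det
            - (∑ l, Real.exp (δ l * t) • S l).det - (∑ l, Real.exp (δ l * t) • T₁ l).det,
         fun t => (((∑ l, Real.exp (δ l * t) • S l) + (∑ l, Real.exp (δ l * t) • T₂ l)).det
            - (∑ l, Real.exp (δ l * t) • S l).det - (∑ l, Real.exp (δ l * t) • T₂ l).det)
            + (∑ l, Real.exp (δ l * t) • T₁ l).det,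
         fun t => ((∑ l, Real.exp (δ l * t) • T₁ l) + (∑ l, Real.exp (δ l * t) • T₂ l)).det
            - (∑ l, Real.exp (δ l * t) • T₁ l).det - (∑ l, Real.exp (δ l * t) • T₂ l).det,
         fun t => (∑ l, Real.exp (δ l * t) • T₂ l).det] n) (z j) = 0)
    (hβ : ∀ j (n : Fin 5), β j ≤ ((n : ℕ) : ℝ) + α j * k j n)
    (σ : (j : Fin r) → Fin (m j + 1) → ℝ) (hσ : ∀ j, StrictMono (σ j)) (hσ0 : ∀ j i, σ j i ≠ 0)
    (ε : (j : Fin r) → Fin (m j + 1) → ℝ) (hεalt : ∀ j (i : Fin (m j)), ε j i.castSucc * ε j i.succ < 0)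
    (hM : ∀ j i, 0 < ε j i * ∑ n : Fin 5, if ((n : ℕ) : ℝ) + α j * k j n = β j then
        iteratedDeriv (k j n)
          (![fun t => (∑ l, Real.exp (δ l * t) • S l).det,
             fun t => ((∑ l, Real.exp (δ l * t) • S l) + (∑ l, Real.exp (δ l * t) • T₁ l)).det
                - (∑ l, Real.exp (δ l * t) • S l).det - (∑ l, Real.exp (δ l * t) • T₁ l).det,
             fun t => (((∑ l, Real.exp (δ l * t) • S l) + (∑ l, Real.exp (δ l * t) • T₂ l)).det
                - (∑ l, Real.exp (δ l * t) • S l).det - (∑ l, Real.exp (δ l * t) • T₂ l).det)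
                + (∑ l, Real.exp (δ l * t) • T₁ l).det,
             fun t => ((∑ l, Real.exp (δ l * t) • T₁ l) + (∑ l, Real.exp (δ l * t) • T₂ l)).det
                - (∑ l, Real.exp (δ l * t) • T₁ l).det - (∑ l, Real.exp (δ l * t) • T₂ l).det,
             fun t => (∑ l, Real.exp (δ l * t) • T₂ l).det] n) (z j) / (k j n).factorial * σ j i ^ (k j n) else 0) :
    δ ∈ TwentyLocus := by
  classical
  let ι := Equiv.Perm (Fin 2) × (Fin 2 → Fin 6)
  let x : ι → ℝ := fun p => ∑ i, δ (p.2 i)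
  let lb : (Fin 6 → Matrix (Fin 2) (Fin 2) ℝ) → ι → ℝ := fun U p => ((Equiv.Perm.sign p.1 : ℤ) : ℝ) * ∏ i, U (p.2 i) (p.1 i) i
  have ev : ∀ (U : Fin 6 → Matrix (Fin 2) (Fin 2) ℝ) (t : ℝ), (∑ l, Real.exp (δ l * t) • U l).det = expSum (lb U) x t :=
    fun U t => congrFun (det_expPencil_eq_expSum_fun δ U) t
  let c : Fin 5 → ι → ℝ := ![lb S, fun p => lb (fun l => S l + T₁ l) p - lb S p - lb T₁ p,
    fun p => (lb (fun l => S l + T₂ l) p - lb S p - lb T₂ p) + lb T₁ p,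
    fun p => lb (fun l => T₁ l + T₂ l) p - lb T₁ p - lb T₂ p, lb T₂]
  have hc : (![fun t => (∑ l, Real.exp (δ l * t) • S l).det,
         fun t => ((∑ l, Real.exp (δ l * t) • S l) + (∑ l, Real.exp (δ l * t) • T₁ l)).det
            - (∑ l, Real.exp (δ l * t) • S l).det - (∑ l, Real.exp (δ l * t) • T₁ l).det,
         fun t => (((∑ l, Real.exp (δ l * t) • S l) + (∑ l, Real.exp (δ l * t) • T₂ l)).det
            - (∑ l, Real.exp (δ l * t) • S l).det - (∑ l, Real.exp (δ l * t) • T₂ l).det)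
            + (∑ l, Real.exp (δ l * t) • T₁ l).det,
         fun t => ((∑ l, Real.exp (δ l * t) • T₁ l) + (∑ l, Real.exp (δ l * t) • T₂ l)).det
            - (∑ l, Real.exp (δ l * t) • T₁ l).det - (∑ l, Real.exp (δ l * t) • T₂ l).det,
         fun t => (∑ l, Real.exp (δ l * t) • T₂ l).det] : Fin 5 → ℝ → ℝ) = fun n => expSum (c n) x := by
    funext n
    fin_cases n
    · funext t; exact ev S t
    · funext t
      show ((∑ l, Real.exp (δ l * t) • S l) + (∑ l, Real.exp (δ l * t) • T₁ l)).det
            - (∑ l, Real.exp (δ l * t) • S l).det - (∑ l, Real.exp (δ l * t) • T₁ l).det = expSum (c 1) x t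
      rw [expPencil_add, ev, ev, ev, expSum_sub_sub]
      rfl
    · funext t
      show (((∑ l, Real.exp (δ l * t) • S l) + (∑ l, Real.exp (δ l * t) • T₂ l)).det
            - (∑ l, Real.exp (δ l * t) • S l).det - (∑ l, Real.exp (δ l * t) • T₂ l).det)
            + (∑ l, Real.exp (δ l * t) • T₁ l).det = expSum (c 2) x t
      rw [expPencil_add, ev, ev, ev, ev, expSum_sub_sub, expSum_add_coeff]
      rfl
    · funext t
      show ((∑ l, Real.exp (δ l * t) • T₁ l) + (∑ l, Real.exp (δ l * t) • T₂ l)).det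
            - (∑ l, Real.exp (δ l * t) • T₁ l).det - (∑ l, Real.exp (δ l * t) • T₂ l).det = expSum (c 3) x t
      rw [expPencil_add, ev, ev, ev, expSum_sub_sub]
      rfl
    · funext t; exact ev T₂ t
  rw [hc] at hvan hM
  let Sη : ℝ → Fin 6 → Matrix (Fin 2) (Fin 2) ℝ := fun η l => S l + η • T₁ l + η ^ 2 • T₂ l
  have hSη : ∀ η l, (Sη η l).IsSymm := fun η l => ((hS l).add ((hT₁ l).smul η)).add ((hT₂ l).smul (η ^ 2))
  have hF : ∀ η t, (∑ l, Real.exp (δ l * t) • Sη η l).det = ∑ n : Fin 5, η ^ (n : ℕ) * expSum (c n) x t := by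
    intro η t
    show (∑ l, Real.exp (δ l * t) • (S l + η • T₁ l + η ^ 2 • T₂ l)).det = _
    rw [expPencil_add_smul_add_smul, det_add_smul_add_smul_fin_two, Fin.sum_univ_five]
    have h0 := congrFun (congrFun hc 0) t
    have h1 := congrFun (congrFun hc 1) t
    have h2 := congrFun (congrFun hc 2) t
    have h3 := congrFun (congrFun hc 3) t
    have h4 := congrFun (congrFun hc 4) t
    simp only [Matrix.cons_val_zero, Matrix.cons_val_one, Matrix.head_cons, Matrix.cons_val_two, Matrix.tail_cons,
      Matrix.cons_val_three, Matrix.cons_val_four] at h0 h1 h2 h3 h4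
    rw [← h0, ← h1, ← h2, ← h3, ← h4, expPencil_add, expPencil_add, expPencil_add]
    simp only [Fin.val_zero, Fin.val_one, Fin.val_two, pow_zero, one_mul, pow_one]
    norm_num
  exact mem_twentyLocus_of_newton_openings δ Sη hSη c x hF z hρ hsep m hm α hα β k hvan hβ σ hσ hσ0 ε hεalt hM

end Summit.ValiantsHypothesis.ValiantsHypothesis.Theorems.LacunarySymmetroidMatrixDescartes.WallBubbling
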